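import Summits.BirchSwinnertonDyer.BirchSwinnertonDyer.Theorems.Rank2Observatory2DescZ2QuadPID
import Summits.BirchSwinnertonDyer.BirchSwinnertonDyer.Theorems.Rank2Observatory2DescZ2Units
import Mathlib.Tactic.NormNum.Prime
import HarnessLib

/-!
# BirchSwinnertonDyer — rank ≥ 2 observatory: the real quadratic field `ℚ(√17)` certified

HONEST FRAMING: per-curve certified theorems and census instruments; no claim on BSD in rank ≥ 2.

Per-field file of the successor instrument KERNEL-2DESC-Z2 (spec
`code/b2b-bsdr2-cert-3/kernel-2desc-z2/README-Z2.md`), the `2`-descent field of the `ℤ/2`-row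
`428298m1` (`θ = −30532 + 4131ω`): `K = ℚ(ω)`, `ω² − ω − 4 = 0`, `Δ = 17`.

* `f = X² − X − 4` irreducible (`17` is not a square), `[K : ℚ] = 2`, `𝓞 K = ℤ[ω]` (`17` squarefree);
* CLASS NUMBER ONE by certificate: Minkowski `√17/2 < 3`, and at `p = 2` (split, `ω ≡ 0, 1`) the
  prime elements `2 − ω`, `−1 − ω` of norm `−2` are killed by the two residue maps;
* unit rank `1`; the units `−1`, `−3 − 2ω` (norm `−1`) are independent modulo squares by the Legendre
  certificates at `ψ₁₃ : ω ↦ 6` (`−1 ↦ 12 = 5²`, `−3 − 2ω ↦ 11`, non-square) and `ψ₁₉ : ω ↦ 7`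
  (`−1 ↦ 18`, `−3 − 2ω ↦ 2`, both non-squares), hence with unit rank `1` every unit is a square times a
  sub-product of them (`units_span`, no fundamental-unit claim needed).

Sorry-free; axioms `propext`, `Classical.choice`, `Quot.sound`. Field data: kit pari j208916.
[cite: Marcus2018, Ch. 2 Ex. 27, Ch. 3 Thm. 22 & 27, Ch. 5 Cor. 2 of Thm. 37]
-/

-- single-conjunct summit: `Summit.BirchSwinnertonDyer.BirchSwinnertonDyer.…` repeats the name by design
set_option linter.dupNamespace false

noncomputable section

open scoped Classical NumberField

open Literature.NumberTheory.NumberFields Polynomial Module NumberField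

namespace Summit.BirchSwinnertonDyer.BirchSwinnertonDyer.Rank2Observatory.TwoDescZ2

open TwoDescCubic

namespace QuadField17

/-! ## The field -/

/-- `Δ(X² − X − 4) = 17`. [folklore] -/
theorem disc_eq : MonicQuad.disc (-1) (-4) = 17 := by norm_num [MonicQuad.disc]

/-- `X² − X − 4` is irreducible over `ℚ` (`17` is not a square: not even modulo `3`). [folklore] -/
theorem irreducible : Irreducible (MonicQuad.polyQ (-1) (-4)) :=
  MonicQuad.irreducible_polyQ (by rw [disc_eq]; exact MonicQuad.not_isSquare_of_zmod 3 (by decide))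

/-- Irreducibility as an instance, so that `QuadField -1 -4` is a field. [folklore] -/
instance : Fact (Irreducible (MonicQuad.polyQ (-1) (-4))) := ⟨irreducible⟩

/-- `f(ω) = 0`. [folklore] -/
theorem aeval_ω : aeval (QuadField.root (-1) (-4)) (MonicQuad.poly (-1) (-4)) = 0 :=
  QuadField.aeval_root (-1) (-4)

/-- `[K : ℚ] = 2`. [folklore] -/
theorem finrank_eq : finrank ℚ (QuadField (-1) (-4)) = 2 := QuadField.finrank_eq (-1) (-4)

/-- `0 < Δ`. [folklore] -/
theorem disc_pos : 0 < MonicQuad.disc (-1) (-4) := by rw [disc_eq]; norm_num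

/-- The index condition (`17` squarefree), so `𝓞 K = ℤ[ω]`. [cite: Marcus2018, Ch. 2, Ex. 27] -/
theorem hsq : ∀ r e : ℤ, MonicQuad.disc (-1) (-4) = r ^ 2 * e → 2 < |e| → IsUnit r :=
  MonicQuad.sqCond_of_squarefree (by
    rw [disc_eq]
    exact_mod_cast Int.squarefree_natCast.mpr (Nat.prime_iff.mp (by norm_num)).squarefree)

/-- `d_K = 17`. [cite: Marcus2018, Ch. 2, Ex. 27] -/
theorem discr_eq : NumberField.discr (QuadField (-1) (-4)) = 17 := by
  rw [MonicQuad.discr_eq_disc irreducible aeval_ω finrank_eq hsq, disc_eq]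

/-- Every algebraic integer is `p + qω`. [cite: Marcus2018, Ch. 2, Ex. 27] -/
theorem exists_int_coords (x : 𝓞 (QuadField (-1) (-4))) :
    ∃ p q : ℤ, (x : QuadField (-1) (-4)) = (p : QuadField (-1) (-4)) + (q : QuadField (-1) (-4)) * QuadField.root (-1) (-4) :=
  MonicQuad.exists_int_coords irreducible aeval_ω finrank_eq hsq x

/-- The relation `ω² = ω + 4` in `𝓞 K`. [folklore] -/
theorem ωi_rel : (MonicQuad.thetaInt aeval_ω) ^ 2 = MonicQuad.thetaInt aeval_ω + 4 := by
  have h := MonicQuad.thetaInt_rel aeval_ω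
  push_cast at h
  linear_combination h

/-! ## Class number one -/

/-- Certificate at `2` (split: `ω ≡ 0` killed by `2 − ω`, `ω ≡ 1` killed by `−1 − ω`, both of norm `−2`).
[cite: Marcus2018, Ch. 3, Thm. 22] -/
theorem cert2 (ψ : 𝓞 (QuadField (-1) (-4)) →+* ZMod 2) : ∃ e : 𝓞 (QuadField (-1) (-4)), ψ e = 0 ∧ Prime e := by
  refine MonicQuad.cert_of_cases aeval_ω ψ (fun t ht _ => ?_)
  have hcases : ∀ t : ZMod 2, t = 0 ∨ t = 1 := by decide
  rcases hcases t with rfl | rfl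
  · exact ⟨MonicQuad.lin aeval_ω 2 (-1), by rw [MonicQuad.map_lin aeval_ω ψ ht]; decide,
      MonicQuad.lin_prime_of_prime irreducible aeval_ω finrank_eq 2 (-1) (n := -2)
        (by norm_num [MonicQuad.normForm]) (by norm_num)⟩
  · exact ⟨MonicQuad.lin aeval_ω (-1) (-1), by rw [MonicQuad.map_lin aeval_ω ψ ht]; decide,
      MonicQuad.lin_prime_of_prime irreducible aeval_ω finrank_eq (-1) (-1) (n := -2)
        (by norm_num [MonicQuad.normForm]) (by norm_num)⟩

/-- The certificate below the Minkowski bound `3`. [cite: Marcus2018, Ch. 5, Cor. 2 of Thm. 37] -/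
theorem cert (p : ℕ) (hp3 : p < 3) (hp : p.Prime) (ψ : 𝓞 (QuadField (-1) (-4)) →+* ZMod p) :
    ∃ e : 𝓞 (QuadField (-1) (-4)), ψ e = 0 ∧ Prime e := by
  interval_cases p
  · exact absurd hp Nat.not_prime_zero
  · exact absurd hp Nat.not_prime_one
  · exact cert2 ψ

/-- **`𝓞 ℚ(√17)` is a principal ideal domain.** [cite: Marcus2018, Ch. 5, Cor. 2 of Thm. 37] -/
instance : IsPrincipalIdealRing (𝓞 (QuadField (-1) (-4))) :=
  isPrincipalIdealRing_of_cert_lt₂ irreducible aeval_ω finrank_eq disc_pos (b' := 3)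
    (by rw [disc_eq]; norm_num) cert

/-! ## Signature, residue maps -/

/-- Unit rank `1`. [cite: Marcus2018, Ch. 5] -/
theorem rank_eq : NumberField.Units.rank (QuadField (-1) (-4)) = 1 :=
  units_rank_eq_one_of_disc_pos irreducible aeval_ω finrank_eq disc_pos

/-- A real embedding exists. [folklore] -/
theorem exists_rho : Nonempty (QuadField (-1) (-4) →+* ℝ) :=
  exists_ringHom_real_of_disc_pos irreducible aeval_ω finrank_eq disc_pos

/-- The residue map `ψ₁₃ : ω ↦ 6`. [cite: Marcus2018, Ch. 3, Thm. 27] -/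
theorem exists_psi13 : ∃ ψ : 𝓞 (QuadField (-1) (-4)) →+* ZMod 13, ψ (MonicQuad.thetaInt aeval_ω) = 6 :=
  MonicQuad.exists_ringHom_of_root irreducible aeval_ω finrank_eq hsq (6 : ZMod 13) (by decide)

/-- The residue map `ψ₁₉ : ω ↦ 7`. [cite: Marcus2018, Ch. 3, Thm. 27] -/
theorem exists_psi19 : ∃ ψ : 𝓞 (QuadField (-1) (-4)) →+* ZMod 19, ψ (MonicQuad.thetaInt aeval_ω) = 7 :=
  MonicQuad.exists_ringHom_of_root irreducible aeval_ω finrank_eq hsq (7 : ZMod 19) (by decide)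

/-- `13` is prime (instance for `legendreSym 13`). [folklore] -/
instance fact_prime_13 : Fact (Nat.Prime 13) := ⟨by norm_num⟩

/-- `19` is prime (instance for `legendreSym 19`). [folklore] -/
instance fact_prime_19 : Fact (Nat.Prime 19) := ⟨by norm_num⟩

/-! ## Units modulo squares -/

/-- The unit `−1`. [folklore] -/
def negOne : (𝓞 (QuadField (-1) (-4)))ˣ :=
  ⟨MonicQuad.lin aeval_ω (-1) 0, MonicQuad.lin aeval_ω (-1) 0, by simp [MonicQuad.lin], by simp [MonicQuad.lin]⟩

/-- The unit `−3 − 2ω` (inverse `5 − 2ω`, norm `−1`). [folklore] -/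
def fu : (𝓞 (QuadField (-1) (-4)))ˣ :=
  ⟨MonicQuad.lin aeval_ω (-3) (-2), MonicQuad.lin aeval_ω 5 (-2),
    by simp only [MonicQuad.lin]; push_cast; linear_combination (4 : 𝓞 (QuadField (-1) (-4))) * ωi_rel,
    by simp only [MonicQuad.lin]; push_cast; linear_combination (4 : 𝓞 (QuadField (-1) (-4))) * ωi_rel⟩

/-- The unit family `(−1, −3 − 2ω)`. [folklore] -/
def units : Fin 2 → (𝓞 (QuadField (-1) (-4)))ˣ := ![negOne, fu]

/-- Images under `ψ₁₃` (`ω ↦ 6`): `−1 ↦ 12`, `−3 − 2ω ↦ 11`. [folklore] -/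
theorem units_psi13 (ψ : 𝓞 (QuadField (-1) (-4)) →+* ZMod 13) (hψ : ψ (MonicQuad.thetaInt aeval_ω) = 6)
    (i : Fin 2) : ψ ((units i : (𝓞 (QuadField (-1) (-4)))ˣ) : 𝓞 (QuadField (-1) (-4))) = ((![12, 11] : Fin 2 → ℤ) i : ZMod 13) := by
  fin_cases i
  · show ψ (MonicQuad.lin aeval_ω (-1) 0) = ((12 : ℤ) : ZMod 13)
    rw [MonicQuad.map_lin aeval_ω ψ hψ]; decide
  · show ψ (MonicQuad.lin aeval_ω (-3) (-2)) = ((11 : ℤ) : ZMod 13)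
    rw [MonicQuad.map_lin aeval_ω ψ hψ]; decide

/-- Images under `ψ₁₉` (`ω ↦ 7`): `−1 ↦ 18`, `−3 − 2ω ↦ 2`. [folklore] -/
theorem units_psi19 (ψ : 𝓞 (QuadField (-1) (-4)) →+* ZMod 19) (hψ : ψ (MonicQuad.thetaInt aeval_ω) = 7)
    (i : Fin 2) : ψ ((units i : (𝓞 (QuadField (-1) (-4)))ˣ) : 𝓞 (QuadField (-1) (-4))) = ((![18, 2] : Fin 2 → ℤ) i : ZMod 19) := by
  fin_cases i
  · show ψ (MonicQuad.lin aeval_ω (-1) 0) = ((18 : ℤ) : ZMod 19)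
    rw [MonicQuad.map_lin aeval_ω ψ hψ]; decide
  · show ψ (MonicQuad.lin aeval_ω (-3) (-2)) = ((2 : ℤ) : ZMod 19)
    rw [MonicQuad.map_lin aeval_ω ψ hψ]; decide

/-- **The unit family spans `(𝓞 K)ˣ` modulo squares** (rank `1`, real field: torsion `±1`); the family is
**independent modulo squares** by the Legendre certificates at `ψ₁₃`, `ψ₁₉` (proved inline — the sibling field
file's `QuadField769.units_indep` has the same shape). [cite: Marcus2018, Ch. 5] -/
theorem units_span (u : (𝓞 (QuadField (-1) (-4)))ˣ) : ∃ T : Finset (Fin 2), IsSquare (u * ∏ i ∈ T, units i) := by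
  have units_indep : ∀ T : Finset (Fin 2), IsSquare (∏ i ∈ T, units i) → T = ∅ := by
    intro T hT
    obtain ⟨ψ13, hψ13⟩ := exists_psi13
    obtain ⟨ψ19, hψ19⟩ := exists_psi19
    have hT' : IsSquare (∏ i ∈ T, ((units i : (𝓞 (QuadField (-1) (-4)))ˣ) : 𝓞 (QuadField (-1) (-4)))) := by
      obtain ⟨r, hr⟩ := hT
      refine ⟨(r : 𝓞 (QuadField (-1) (-4))), ?_⟩
      have h := congrArg (fun z : (𝓞 (QuadField (-1) (-4)))ˣ => (z : 𝓞 (QuadField (-1) (-4)))) hr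
      simpa only [Units.coe_prod, Units.val_mul] using h
    refine indep_of_parity_certificate
      (fun i => ((units i : (𝓞 (QuadField (-1) (-4)))ˣ) : 𝓞 (QuadField (-1) (-4))))
      (![![false, true], ![true, true]] : Fin 2 → Fin 2 → Bool) ?_ (by decide) T hT'
    intro k S hS
    fin_cases k
    · have h := even_card_of_isSquare_legendre (p := 13) ψ13
        (fun i => ((units i : (𝓞 (QuadField (-1) (-4)))ˣ) : 𝓞 (QuadField (-1) (-4))))
        (![12, 11] : Fin 2 → ℤ) (units_psi13 ψ13 hψ13) (by decide) hS
      have h1 : legendreSym 13 12 = 1 :=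
        (legendreSym.eq_one_iff 13 (by decide)).mpr ⟨5, by decide⟩
      have h2 : legendreSym 13 11 = -1 :=
        (legendreSym.eq_neg_one_iff 13).mpr (by unfold IsSquare; decide)
      convert h using 2
      refine Finset.filter_congr (fun i _ => ?_)
      fin_cases i
      · simp [h1]
      · simp [h2]
    · have h := even_card_of_isSquare_legendre (p := 19) ψ19
        (fun i => ((units i : (𝓞 (QuadField (-1) (-4)))ˣ) : 𝓞 (QuadField (-1) (-4))))
        (![18, 2] : Fin 2 → ℤ) (units_psi19 ψ19 hψ19) (by decide) hS
      have h1 : legendreSym 19 18 = -1 :=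
        (legendreSym.eq_neg_one_iff 19).mpr (by unfold IsSquare; decide)
      have h2 : legendreSym 19 2 = -1 :=
        (legendreSym.eq_neg_one_iff 19).mpr (by unfold IsSquare; decide)
      convert h using 2
      refine Finset.filter_congr (fun i _ => ?_)
      fin_cases i
      · simp [h1]
      · simp [h2]
  obtain ⟨ρ⟩ := exists_rho
  exact exists_isSquare_unit_mul_prod_of_real ρ (by rw [rank_eq]) units units_indep u

end QuadField17

end Summit.BirchSwinnertonDyer.BirchSwinnertonDyer.Rank2Observatory.TwoDescZ2

end
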